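import Summits.NavierStokesRegularity.NavierStokesRegularity.Theorems.TypeIIInviscidRelaxationOneSidedRadialCriterionEnergyClassLoadBearing
import Summits.NavierStokesRegularity.NavierStokesRegularity.Theorems.TypeIIInviscidRelaxationCoreExclusionShadowingFlatCore

/-!
# Cruxes `ColumnarCoreExclusion` (stmt-NavierStokesRegularity-1966) / `MonopoleCoreExclusion` (stmt-1965), negative side:
# in both registered [XL] shadowing stubs the finite-energy (Leray–Hopf) clause is load-bearing — neither stub is a ball-local statement

`--supports stmt-NavierStokesRegularity-1966` (helper file; theorems only, no definitions, no `sorry`).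

The two open [XL] stubs `stub_columnarShadowing` (line `columnar_comparison_flow`, 1966) and `stub_axisymShadowing`
(line `axisymmetric_comparison_flow`, 1965) conclude a LOCAL bound — `u` bounded on `[t, T) × B(x₀, 3KL/8)` (resp.
`× B(x₀, KL/2)`) — from the core normalisation at time `t`, the horizon `(T - t)V ≤ KL`, and `C⁰`-closeness on a ball
to a bounded comparison flow `v` of the class.  Their docstrings name "pressure is non-local" as a reason they might
fail.  This file turns that remark into kernel facts saying which hypothesis any proof must route through:

* `not_ballBounded_axial_drift` — the axial member `u(t, x) = -log(1 - t) e_z`, `p = -(1 - t)⁻¹ x₂` (`T = 1`, any `ν`)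
  of the parasitic family of Koch–Nadirashvili–Seregin–Šverák (Acta Math. 203 (2009), §1 p. 3; in tree as
  `Target.Negative.uniformVel driftAmp e₂`, `OneSidedRadialCriterionLoadBearing.isClassical_axial_drift`) is unbounded
  on `[t, 1) × B(x₀, r)` for EVERY `t < 1`, `x₀`, `r > 0`: a linear pressure drives blow-up inside every ball while the
  slice at time `t` is exactly the constant stream `v ≡ u(t)` — itself a bounded, columnar AND axisymmetric, classical
  solution on `[t, 1]` (`CoreExclusionShadowing.isClassicalNSSolutionOn_constVec`), closeness error `0`.
* `axial_drift_defeats_columnarShadowing` / `axial_drift_defeats_axisymShadowing` — at every level `K ≥ 1` and every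
  `A > 0` the body of the stub, with `IsLerayHopfOn T ν 0 (u 0) u` replaced by the bundle [pressure-free WEAK formulation
  `IsWeakNSSolutionOn T ν 0 (u 0) u` ∧ Type-I rate at `T` ∧ bounded on every closed sub-slab ∧ axisymmetric slices], is
  refuted by that witness (`ν = 1`, `T = 1`, `t = 1/2`, `x₀ = 0`, `V = log 2`, `L = K/V + K`, `Q = id`): none of these
  additions substitutes for the energy class.
* `columnarShadowing_false_without_lerayHopf`, `columnarShadowing_false_without_energy` and the two `axisymShadowing_…`
  twins — the registered statements with the Leray–Hopf clause DELETED, resp. WEAKENED to the weak formulation, are FALSE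
  (everything else verbatim).

Reading for the two stubs: of the standing class exactly `u(s) ∈ L²(ℝ³)` / the energy inequality is what a proof must
USE — no argument local to `[t, T) × B(x₀, KL)` (local energy inequality on the ball, interior parabolic regularity,
comparison with `v` inside the ball, the horizon) can by itself bound `u` there, because all of those are satisfied by
the drift; the global energy class is what pins the Galilean frame / excludes the harmonic linear pressure (tree barrier
`Literature.Barriers.NavierStokesRegularity.GalileanFrameSlot`).  Consistent with `CoreExclusionConsistency`
(p834924: WITH the clause each stub ⟺ its blow-up form).  Nothing here closes an item; no stub is proved or refuted as
registered; Navier–Stokes regularity is not touched. [cite: KochNadirashviliSereginSverak2009, §1 p. 3 (parasitic solutions)]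
-/

noncomputable section

open MeasureTheory Set Function Filter Metric
open scoped Topology
open Literature.Analysis.FluidPDE
open Summit.NavierStokesRegularity.NavierStokesRegularity.Theorems.Target.Negative
open Summit.NavierStokesRegularity.NavierStokesRegularity.Theorems.OneSidedRadialCriterionLoadBearing
open Summit.NavierStokesRegularity.NavierStokesRegularity.Theorems.CoreExclusionShadowing

namespace Summit.NavierStokesRegularity.NavierStokesRegularity.Theorems.CoreExclusionShadowingLoadBearing

-- the problem directory repeats the summit name (`NavierStokesRegularity/NavierStokesRegularity`)
set_option linter.dupNamespace false

/-! ## §1 The axial drift inside a ball -/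

/-- The amplitude of the axial drift at `t = 1/2` is `-log(1/2) = log 2`. -/
theorem driftAmp_half : driftAmp (1 / 2) = Real.log 2 := by
  unfold driftAmp
  rw [show (1 : ℝ) - 1 / 2 = (2 : ℝ)⁻¹ by norm_num, Real.log_inv, neg_neg]

/-- `0 < log 2 = driftAmp (1/2)`. -/
theorem driftAmp_half_pos : 0 < driftAmp (1 / 2) := by
  rw [driftAmp_half]
  exact Real.log_pos (by norm_num)

/-- `driftAmp (1/2) = log 2 < 1`. -/
theorem driftAmp_half_lt_one : driftAmp (1 / 2) < 1 := by
  rw [driftAmp_half]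
  have h := Real.log_lt_sub_one_of_pos (show (0 : ℝ) < 2 by norm_num) (by norm_num)
  linarith

/-- **Late large amplitudes**: for every `M` and every `t < 1` there is `s ∈ [t, 1)`, `0 ≤ s`, with `M < -log(1 - s)`. -/
theorem exists_late_driftAmp_gt (M : ℝ) {t : ℝ} (ht : t < 1) :
    ∃ s : ℝ, max t 0 ≤ s ∧ s < 1 ∧ M < driftAmp s := by
  have h1 : ∀ᶠ s in 𝓝[<] (1 : ℝ), M < driftAmp s :=
    tendsto_driftAmp_atTop.eventually (eventually_gt_atTop M)
  have h2 : ∀ᶠ s in 𝓝[<] (1 : ℝ), s ∈ Ioo (max t 0) 1 :=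
    Ioo_mem_nhdsLT (max_lt ht one_pos)
  obtain ⟨s, hsM, hs⟩ := (h1.and h2).exists
  exact ⟨s, hs.1.le, hs.2, hsM⟩

/-- **The axial drift is unbounded on every forward cylinder `[t, 1) × B(x₀, r)`** (`t < 1`, `r > 0`): the linear
pressure `-(1 - s)⁻¹ x₂` accelerates the fluid inside every ball, `‖u(s, x₀)‖ = -log(1 - s) → ∞`. -/
theorem not_ballBounded_axial_drift {t r : ℝ} (ht : t < 1) (hr : 0 < r) (x₀ : EuclideanSpace ℝ (Fin 3)) :
    ¬ ∃ M : ℝ, ∀ s ∈ Ico t 1, ∀ x ∈ ball x₀ r,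
      ‖uniformVel driftAmp (EuclideanSpace.single (2 : Fin 3) (1 : ℝ)) s x‖ ≤ M := by
  rintro ⟨M, hM⟩
  obtain ⟨s, hs0, hs1, hsM⟩ := exists_late_driftAmp_gt M ht
  have h := hM s ⟨(le_max_left t 0).trans hs0, hs1⟩ x₀ (mem_ball_self hr)
  rw [norm_axial_drift ⟨(le_max_right t 0).trans hs0, hs1⟩] at h
  exact absurd (hsM.trans_le h) (lt_irrefl M)

/-- The core length used at level `K`: `L = K / V + K` is positive for `K ≥ 1`, `V > 0`. -/
theorem coreLength_pos {K V : ℝ} (hK : 1 ≤ K) (hV : 0 < V) : 0 < K / V + K := by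
  have hK0 : 0 < K := one_pos.trans_le hK
  positivity

/-- Reynolds clause at level `K`: `K · 1 ≤ (K / V + K) · V` (`= K + K V`). -/
theorem reynolds_coreLength {K V : ℝ} (hK : 1 ≤ K) (hV : 0 < V) : K * 1 ≤ (K / V + K) * V := by
  have hK0 : 0 ≤ K := zero_le_one.trans hK
  have h : (K / V + K) * V = K + K * V := by
    field_simp
  rw [h, mul_one]
  nlinarith

/-- Horizon clause at level `K`: `(1 - 1/2) · V ≤ K · (K / V + K)` when `V < 1 ≤ K`. -/
theorem horizon_coreLength {K V : ℝ} (hK : 1 ≤ K) (hV : 0 < V) (hV1 : V < 1) :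
    (1 - 1 / 2) * V ≤ K * (K / V + K) := by
  have hKV : 0 ≤ K / V := div_nonneg (zero_le_one.trans hK) hV.le
  nlinarith

/-! ## §2 The columnar shadowing stub (1966) without the energy class -/

/-- **The axial drift defeats the body of `stub_columnarShadowing` at every level** once `IsLerayHopfOn` is replaced
by [weak formulation ∧ Type-I rate ∧ closed-sub-slab bounds ∧ axisymmetric slices]: instantiate at `ν = 1`, `T = 1`,
`t = 1/2`, `u` = axial drift, `x₀ = 0`, `V = log 2`, `L = K/V + K`, `Q = id`, `v ≡ u(1/2)` (zero pressure,
`Mv = ‖u(1/2)‖`, closeness error `0`), and read off a bound on `[1/2, 1) × B(0, 3KL/8)` — impossible. -/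
theorem axial_drift_defeats_columnarShadowing {A K : ℝ} (hA : 0 < A) (hK : 1 ≤ K)
    (h : ∀ (ν T t : ℝ) (u : ℝ → EuclideanSpace ℝ (Fin 3) → EuclideanSpace ℝ (Fin 3))
        (p : ℝ → EuclideanSpace ℝ (Fin 3) → ℝ),
        0 < ν → 0 < T → IsClassicalNSSolutionOn (Ico 0 T) ν 0 u p → IsWeakNSSolutionOn T ν 0 (u 0) u →
        IsTypeIBlowup u T → (∀ T' < T, ∃ M : ℝ, ∀ s ∈ Icc 0 T', ∀ x, ‖u s x‖ ≤ M) →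
        (∀ s ∈ Ico 0 T, IsAxisymmetric (u s)) →
        HasRapidSpatialDecay (u 0) → 0 < t → t < T →
        ∀ (x₀ : EuclideanSpace ℝ (Fin 3)) (L V : ℝ)
          (Q : EuclideanSpace ℝ (Fin 3) ≃ₗᵢ[ℝ] EuclideanSpace ℝ (Fin 3)),
          0 < L → 0 < V → (∀ x, ‖u t x‖ ≤ V) →
          (∃ x₁, dist x₁ x₀ ≤ L ∧ V ≤ 2 * ‖u t x₁‖) → K * ν ≤ L * V → (T - t) * V ≤ K * L →
          ∀ (v : ℝ → EuclideanSpace ℝ (Fin 3) → EuclideanSpace ℝ (Fin 3))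
            (q : ℝ → EuclideanSpace ℝ (Fin 3) → ℝ) (Mv : ℝ),
            IsClassicalNSSolutionOn (Icc t T) ν 0 v q →
            (∀ s ∈ Icc t T, ∀ (x : EuclideanSpace ℝ (Fin 3)) (τ : ℝ), v s (x + τ • Q eZ) = v s x) →
            (∀ s ∈ Icc t T, ∀ x, ‖v s x‖ ≤ Mv) →
            (∀ x ∈ ball x₀ (K * L / 2), ‖u t x - v t x‖ ≤ A * V / K) →
            ∃ M : ℝ, ∀ s ∈ Ico t T, ∀ x ∈ ball x₀ (3 * K * L / 8), ‖u s x‖ ≤ M) : False := by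
  set V : ℝ := driftAmp (1 / 2) with hVdef
  have hV : 0 < V := driftAmp_half_pos
  have hV1 : V < 1 := driftAmp_half_lt_one
  have hK0 : 0 < K := one_pos.trans_le hK
  have hL : 0 < K / V + K := coreLength_pos hK hV
  set c : EuclideanSpace ℝ (Fin 3) := V • (EuclideanSpace.single (2 : Fin 3) (1 : ℝ)) with hcdef
  have hslice : ∀ x : EuclideanSpace ℝ (Fin 3),
      uniformVel driftAmp (EuclideanSpace.single (2 : Fin 3) (1 : ℝ)) (1 / 2) x = c := fun _ => rfl
  have hnorm : ∀ x : EuclideanSpace ℝ (Fin 3),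
      ‖uniformVel driftAmp (EuclideanSpace.single (2 : Fin 3) (1 : ℝ)) (1 / 2) x‖ = V := fun x =>
    norm_axial_drift ⟨by norm_num, by norm_num⟩ x
  have hconcl := h 1 1 (1 / 2) _ _ one_pos one_pos (isClassical_axial_drift 1) (isWeak_axial_drift 1)
    isTypeIBlowup_axial_drift bounded_subslab_axial_drift (fun s _ => isAxisymmetric_axial_drift s)
    hasRapidSpatialDecay_axial_drift_zero (by norm_num) (by norm_num)
    0 (K / V + K) V (LinearIsometryEquiv.refl ℝ _) hL hV (fun x => (hnorm x).le)
    ⟨0, by rw [dist_self]; exact hL.le, by rw [hnorm 0]; linarith⟩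
    (reynolds_coreLength hK hV) (horizon_coreLength hK hV hV1)
    (fun _ _ => c) (fun _ _ => 0) ‖c‖ (isClassicalNSSolutionOn_constVec (Icc (1 / 2) 1) 1 c)
    (fun _ _ _ _ => rfl) (fun _ _ _ => le_rfl)
    (fun x _ => by rw [hslice x, sub_self, norm_zero]; positivity)
  have hr : 0 < 3 * K * (K / V + K) / 8 := by positivity
  exact not_ballBounded_axial_drift (by norm_num) hr 0 hconcl

/-- **`stub_columnarShadowing` with the Leray–Hopf clause DELETED is FALSE** (everything else verbatim). Any proof of
the registered stub must use `IsLerayHopfOn T ν 0 (u 0) u`. -/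
theorem columnarShadowing_false_without_lerayHopf :
    ¬ (∀ A : ℝ, 0 < A → ∃ K₀ : ℝ, 1 ≤ K₀ ∧ ∀ K : ℝ, K₀ ≤ K →
      ∀ (ν T t : ℝ) (u : ℝ → EuclideanSpace ℝ (Fin 3) → EuclideanSpace ℝ (Fin 3))
        (p : ℝ → EuclideanSpace ℝ (Fin 3) → ℝ),
        0 < ν → 0 < T → IsClassicalNSSolutionOn (Ico 0 T) ν 0 u p →
        HasRapidSpatialDecay (u 0) → 0 < t → t < T →
        ∀ (x₀ : EuclideanSpace ℝ (Fin 3)) (L V : ℝ)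
          (Q : EuclideanSpace ℝ (Fin 3) ≃ₗᵢ[ℝ] EuclideanSpace ℝ (Fin 3)),
          0 < L → 0 < V → (∀ x, ‖u t x‖ ≤ V) →
          (∃ x₁, dist x₁ x₀ ≤ L ∧ V ≤ 2 * ‖u t x₁‖) → K * ν ≤ L * V → (T - t) * V ≤ K * L →
          ∀ (v : ℝ → EuclideanSpace ℝ (Fin 3) → EuclideanSpace ℝ (Fin 3))
            (q : ℝ → EuclideanSpace ℝ (Fin 3) → ℝ) (Mv : ℝ),
            IsClassicalNSSolutionOn (Icc t T) ν 0 v q →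
            (∀ s ∈ Icc t T, ∀ (x : EuclideanSpace ℝ (Fin 3)) (τ : ℝ), v s (x + τ • Q eZ) = v s x) →
            (∀ s ∈ Icc t T, ∀ x, ‖v s x‖ ≤ Mv) →
            (∀ x ∈ ball x₀ (K * L / 2), ‖u t x - v t x‖ ≤ A * V / K) →
            ∃ M : ℝ, ∀ s ∈ Ico t T, ∀ x ∈ ball x₀ (3 * K * L / 8), ‖u s x‖ ≤ M) := by
  intro h
  obtain ⟨K₀, hK₀, hK⟩ := h 1 one_pos
  exact axial_drift_defeats_columnarShadowing one_pos hK₀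
    (fun ν T t u p hν hT hcl _ _ _ _ hdec ht htT x₀ L V Q hL hV hbd hnear hRe hlate v q Mv hv hvcol hvbd hvclose =>
      hK K₀ le_rfl ν T t u p hν hT hcl hdec ht htT x₀ L V Q hL hV hbd hnear hRe hlate v q Mv hv hvcol hvbd hvclose)

/-- **Of the Leray–Hopf bundle exactly the finite-energy clauses are load-bearing in `stub_columnarShadowing`**: the
registered statement with `IsLerayHopfOn T ν 0 (u 0) u` WEAKENED to its first field, the pressure-free weak formulation
`IsWeakNSSolutionOn T ν 0 (u 0) u`, is still FALSE. -/
theorem columnarShadowing_false_without_energy :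
    ¬ (∀ A : ℝ, 0 < A → ∃ K₀ : ℝ, 1 ≤ K₀ ∧ ∀ K : ℝ, K₀ ≤ K →
      ∀ (ν T t : ℝ) (u : ℝ → EuclideanSpace ℝ (Fin 3) → EuclideanSpace ℝ (Fin 3))
        (p : ℝ → EuclideanSpace ℝ (Fin 3) → ℝ),
        0 < ν → 0 < T → IsClassicalNSSolutionOn (Ico 0 T) ν 0 u p → IsWeakNSSolutionOn T ν 0 (u 0) u →
        HasRapidSpatialDecay (u 0) → 0 < t → t < T →
        ∀ (x₀ : EuclideanSpace ℝ (Fin 3)) (L V : ℝ)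
          (Q : EuclideanSpace ℝ (Fin 3) ≃ₗᵢ[ℝ] EuclideanSpace ℝ (Fin 3)),
          0 < L → 0 < V → (∀ x, ‖u t x‖ ≤ V) →
          (∃ x₁, dist x₁ x₀ ≤ L ∧ V ≤ 2 * ‖u t x₁‖) → K * ν ≤ L * V → (T - t) * V ≤ K * L →
          ∀ (v : ℝ → EuclideanSpace ℝ (Fin 3) → EuclideanSpace ℝ (Fin 3))
            (q : ℝ → EuclideanSpace ℝ (Fin 3) → ℝ) (Mv : ℝ),
            IsClassicalNSSolutionOn (Icc t T) ν 0 v q →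
            (∀ s ∈ Icc t T, ∀ (x : EuclideanSpace ℝ (Fin 3)) (τ : ℝ), v s (x + τ • Q eZ) = v s x) →
            (∀ s ∈ Icc t T, ∀ x, ‖v s x‖ ≤ Mv) →
            (∀ x ∈ ball x₀ (K * L / 2), ‖u t x - v t x‖ ≤ A * V / K) →
            ∃ M : ℝ, ∀ s ∈ Ico t T, ∀ x ∈ ball x₀ (3 * K * L / 8), ‖u s x‖ ≤ M) := by
  intro h
  obtain ⟨K₀, hK₀, hK⟩ := h 1 one_pos
  exact axial_drift_defeats_columnarShadowing one_pos hK₀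
    (fun ν T t u p hν hT hcl hweak _ _ _ hdec ht htT x₀ L V Q hL hV hbd hnear hRe hlate v q Mv hv hvcol hvbd hvclose =>
      hK K₀ le_rfl ν T t u p hν hT hcl hweak hdec ht htT x₀ L V Q hL hV hbd hnear hRe hlate v q Mv hv hvcol hvbd
        hvclose)

/-! ## §3 The axisymmetric shadowing stub (1965) without the energy class -/

/-- **The axial drift defeats the body of `stub_axisymShadowing` at every level** once `IsLerayHopfOn` is replaced by
[weak formulation ∧ Type-I rate ∧ closed-sub-slab bounds ∧ axisymmetric slices]: same instantiation as in the
columnar case; in the frame `Q = id`, `x₀ = 0` the comparison stream `v ≡ log 2 · e_z` pulls back to itself, an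
axisymmetric field; the bound on `[1/2, 1) × B(0, KL/2)` is impossible. -/
theorem axial_drift_defeats_axisymShadowing {A K : ℝ} (hA : 0 < A) (hK : 1 ≤ K)
    (h : ∀ (ν T t : ℝ) (u : ℝ → EuclideanSpace ℝ (Fin 3) → EuclideanSpace ℝ (Fin 3))
        (p : ℝ → EuclideanSpace ℝ (Fin 3) → ℝ),
        0 < ν → 0 < T → IsClassicalNSSolutionOn (Ico 0 T) ν 0 u p → IsWeakNSSolutionOn T ν 0 (u 0) u →
        IsTypeIBlowup u T → (∀ T' < T, ∃ M : ℝ, ∀ s ∈ Icc 0 T', ∀ x, ‖u s x‖ ≤ M) →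
        (∀ s ∈ Ico 0 T, IsAxisymmetric (u s)) →
        HasRapidSpatialDecay (u 0) → 0 < t → t < T →
        ∀ (x₀ : EuclideanSpace ℝ (Fin 3)) (L V : ℝ)
          (Q : EuclideanSpace ℝ (Fin 3) ≃ₗᵢ[ℝ] EuclideanSpace ℝ (Fin 3)),
          0 < L → 0 < V → (∀ x, ‖u t x‖ ≤ V) →
          (∃ x₁, dist x₁ x₀ ≤ L ∧ V ≤ 2 * ‖u t x₁‖) → K * ν ≤ L * V → (T - t) * V ≤ K * L →
          ∀ (v : ℝ → EuclideanSpace ℝ (Fin 3) → EuclideanSpace ℝ (Fin 3))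
            (q : ℝ → EuclideanSpace ℝ (Fin 3) → ℝ) (Mv : ℝ),
            IsClassicalNSSolutionOn (Icc t T) ν 0 v q →
            (∀ s ∈ Icc t T, IsAxisymmetric (fun y : EuclideanSpace ℝ (Fin 3) => Q.symm (v s (x₀ + Q y)))) →
            (∀ s ∈ Icc t T, ∀ x, ‖v s x‖ ≤ Mv) →
            (∀ x ∈ ball x₀ (K * L), ‖u t x - v t x‖ ≤ A * V / K) →
            ∃ M : ℝ, ∀ s ∈ Ico t T, ∀ x ∈ ball x₀ (K * L / 2), ‖u s x‖ ≤ M) : False := by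
  set V : ℝ := driftAmp (1 / 2) with hVdef
  have hV : 0 < V := driftAmp_half_pos
  have hV1 : V < 1 := driftAmp_half_lt_one
  have hK0 : 0 < K := one_pos.trans_le hK
  have hL : 0 < K / V + K := coreLength_pos hK hV
  set c : EuclideanSpace ℝ (Fin 3) := V • (EuclideanSpace.single (2 : Fin 3) (1 : ℝ)) with hcdef
  have hslice : ∀ x : EuclideanSpace ℝ (Fin 3),
      uniformVel driftAmp (EuclideanSpace.single (2 : Fin 3) (1 : ℝ)) (1 / 2) x = c := fun _ => rfl
  have hnorm : ∀ x : EuclideanSpace ℝ (Fin 3),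
      ‖uniformVel driftAmp (EuclideanSpace.single (2 : Fin 3) (1 : ℝ)) (1 / 2) x‖ = V := fun x =>
    norm_axial_drift ⟨by norm_num, by norm_num⟩ x
  have hax : ∀ s ∈ Icc (1 / 2 : ℝ) 1, IsAxisymmetric (fun y : EuclideanSpace ℝ (Fin 3) =>
      (LinearIsometryEquiv.refl ℝ (EuclideanSpace ℝ (Fin 3))).symm
        ((fun (_ : ℝ) (_ : EuclideanSpace ℝ (Fin 3)) => c) s
          (0 + (LinearIsometryEquiv.refl ℝ (EuclideanSpace ℝ (Fin 3))) y))) := by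
    intro s _
    have hfun : (fun y : EuclideanSpace ℝ (Fin 3) =>
        (LinearIsometryEquiv.refl ℝ (EuclideanSpace ℝ (Fin 3))).symm
          ((fun (_ : ℝ) (_ : EuclideanSpace ℝ (Fin 3)) => c) s
            (0 + (LinearIsometryEquiv.refl ℝ (EuclideanSpace ℝ (Fin 3))) y))) =
        uniformVel driftAmp (EuclideanSpace.single (2 : Fin 3) (1 : ℝ)) (1 / 2) := by
      funext y
      rfl
    rw [hfun]
    exact isAxisymmetric_axial_drift (1 / 2)
  have hconcl := h 1 1 (1 / 2) _ _ one_pos one_pos (isClassical_axial_drift 1) (isWeak_axial_drift 1)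
    isTypeIBlowup_axial_drift bounded_subslab_axial_drift (fun s _ => isAxisymmetric_axial_drift s)
    hasRapidSpatialDecay_axial_drift_zero (by norm_num) (by norm_num)
    0 (K / V + K) V (LinearIsometryEquiv.refl ℝ _) hL hV (fun x => (hnorm x).le)
    ⟨0, by rw [dist_self]; exact hL.le, by rw [hnorm 0]; linarith⟩
    (reynolds_coreLength hK hV) (horizon_coreLength hK hV hV1)
    (fun _ _ => c) (fun _ _ => 0) ‖c‖ (isClassicalNSSolutionOn_constVec (Icc (1 / 2) 1) 1 c)
    hax (fun _ _ _ => le_rfl)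
    (fun x _ => by rw [hslice x, sub_self, norm_zero]; positivity)
  have hr : 0 < K * (K / V + K) / 2 := by positivity
  exact not_ballBounded_axial_drift (by norm_num) hr 0 hconcl

/-- **`stub_axisymShadowing` with the Leray–Hopf clause DELETED is FALSE** (everything else verbatim). Any proof of
the registered stub must use `IsLerayHopfOn T ν 0 (u 0) u`. -/
theorem axisymShadowing_false_without_lerayHopf :
    ¬ (∀ A : ℝ, 0 < A → ∃ K₀ : ℝ, 1 ≤ K₀ ∧ ∀ K : ℝ, K₀ ≤ K →
      ∀ (ν T t : ℝ) (u : ℝ → EuclideanSpace ℝ (Fin 3) → EuclideanSpace ℝ (Fin 3))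
        (p : ℝ → EuclideanSpace ℝ (Fin 3) → ℝ),
        0 < ν → 0 < T → IsClassicalNSSolutionOn (Ico 0 T) ν 0 u p →
        HasRapidSpatialDecay (u 0) → 0 < t → t < T →
        ∀ (x₀ : EuclideanSpace ℝ (Fin 3)) (L V : ℝ)
          (Q : EuclideanSpace ℝ (Fin 3) ≃ₗᵢ[ℝ] EuclideanSpace ℝ (Fin 3)),
          0 < L → 0 < V → (∀ x, ‖u t x‖ ≤ V) →
          (∃ x₁, dist x₁ x₀ ≤ L ∧ V ≤ 2 * ‖u t x₁‖) → K * ν ≤ L * V → (T - t) * V ≤ K * L →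
          ∀ (v : ℝ → EuclideanSpace ℝ (Fin 3) → EuclideanSpace ℝ (Fin 3))
            (q : ℝ → EuclideanSpace ℝ (Fin 3) → ℝ) (Mv : ℝ),
            IsClassicalNSSolutionOn (Icc t T) ν 0 v q →
            (∀ s ∈ Icc t T, IsAxisymmetric (fun y : EuclideanSpace ℝ (Fin 3) => Q.symm (v s (x₀ + Q y)))) →
            (∀ s ∈ Icc t T, ∀ x, ‖v s x‖ ≤ Mv) →
            (∀ x ∈ ball x₀ (K * L), ‖u t x - v t x‖ ≤ A * V / K) →
            ∃ M : ℝ, ∀ s ∈ Ico t T, ∀ x ∈ ball x₀ (K * L / 2), ‖u s x‖ ≤ M) := by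
  intro h
  obtain ⟨K₀, hK₀, hK⟩ := h 1 one_pos
  exact axial_drift_defeats_axisymShadowing one_pos hK₀
    (fun ν T t u p hν hT hcl _ _ _ _ hdec ht htT x₀ L V Q hL hV hbd hnear hRe hlate v q Mv hv hvax hvbd hvclose =>
      hK K₀ le_rfl ν T t u p hν hT hcl hdec ht htT x₀ L V Q hL hV hbd hnear hRe hlate v q Mv hv hvax hvbd hvclose)

/-- **Of the Leray–Hopf bundle exactly the finite-energy clauses are load-bearing in `stub_axisymShadowing`**: the
registered statement with `IsLerayHopfOn T ν 0 (u 0) u` WEAKENED to the pressure-free weak formulation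
`IsWeakNSSolutionOn T ν 0 (u 0) u` is still FALSE. -/
theorem axisymShadowing_false_without_energy :
    ¬ (∀ A : ℝ, 0 < A → ∃ K₀ : ℝ, 1 ≤ K₀ ∧ ∀ K : ℝ, K₀ ≤ K →
      ∀ (ν T t : ℝ) (u : ℝ → EuclideanSpace ℝ (Fin 3) → EuclideanSpace ℝ (Fin 3))
        (p : ℝ → EuclideanSpace ℝ (Fin 3) → ℝ),
        0 < ν → 0 < T → IsClassicalNSSolutionOn (Ico 0 T) ν 0 u p → IsWeakNSSolutionOn T ν 0 (u 0) u →
        HasRapidSpatialDecay (u 0) → 0 < t → t < T →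
        ∀ (x₀ : EuclideanSpace ℝ (Fin 3)) (L V : ℝ)
          (Q : EuclideanSpace ℝ (Fin 3) ≃ₗᵢ[ℝ] EuclideanSpace ℝ (Fin 3)),
          0 < L → 0 < V → (∀ x, ‖u t x‖ ≤ V) →
          (∃ x₁, dist x₁ x₀ ≤ L ∧ V ≤ 2 * ‖u t x₁‖) → K * ν ≤ L * V → (T - t) * V ≤ K * L →
          ∀ (v : ℝ → EuclideanSpace ℝ (Fin 3) → EuclideanSpace ℝ (Fin 3))
            (q : ℝ → EuclideanSpace ℝ (Fin 3) → ℝ) (Mv : ℝ),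
            IsClassicalNSSolutionOn (Icc t T) ν 0 v q →
            (∀ s ∈ Icc t T, IsAxisymmetric (fun y : EuclideanSpace ℝ (Fin 3) => Q.symm (v s (x₀ + Q y)))) →
            (∀ s ∈ Icc t T, ∀ x, ‖v s x‖ ≤ Mv) →
            (∀ x ∈ ball x₀ (K * L), ‖u t x - v t x‖ ≤ A * V / K) →
            ∃ M : ℝ, ∀ s ∈ Ico t T, ∀ x ∈ ball x₀ (K * L / 2), ‖u s x‖ ≤ M) := by
  intro h
  obtain ⟨K₀, hK₀, hK⟩ := h 1 one_pos
  exact axial_drift_defeats_axisymShadowing one_pos hK₀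
    (fun ν T t u p hν hT hcl hweak _ _ _ hdec ht htT x₀ L V Q hL hV hbd hnear hRe hlate v q Mv hv hvax hvbd hvclose =>
      hK K₀ le_rfl ν T t u p hν hT hcl hweak hdec ht htT x₀ L V Q hL hV hbd hnear hRe hlate v q Mv hv hvax hvbd
        hvclose)

end Summit.NavierStokesRegularity.NavierStokesRegularity.Theorems.CoreExclusionShadowingLoadBearing

end
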